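import Mathlib
import Literature.Geometry.Manifold.FlowOutChart
import HarnessLib

/-!
# N1 ▸ `node_N1_move` ▸ (d) N1-mono (the deep-belt monodromy model), brick J1-(d7):
# THE FLOW OF THE TRANSVERSAL FIELD IN FLAT BELT COORDINATES — deck equivariance, level transport,
# uniqueness, and the flow-out chart (immersion, injectivity)
(wave 8, crux stmt-SmoothPoincare4-10508, line `modp-braid-orbits`, registered stub `stub_M2geo` (N1) ▸
`node_N1_move` ▸ sub-node (d) = H4's `helper_N1_beltMonodromy`; analytic layer of piece (d7) of
`work/stubs/H4-REPORT.md` §4; registered sub-goal `helper_beltFlowChart`)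

The glued belt chart of (d) is `Λ (u', r', σ) := B (desc (Fl (lift (χ̂ (u', r', σ₀))) (σ − σ₀)))`: the flow-out,
along the complete `1`-periodic transversal field `V` of piece (d6) (`…BeltMonodromyField.lean`, `dQ (V) = 1`
near the belt circle, `V = W :=` the pushed chart field off the core zone), of the level-`σ₀` slice of the seam-lift
chart read in flat belt coordinates `x = (u, m) ∈ ℝ × ℝ²`.  This file proves the FLAT FLOW PACKAGE the assembly
and the return map (d8) consume, around the tree's complete flow `Fl x t := Literature.Analysis.ODE.globalFlow hK hL x t`
of a globally Lipschitz bounded smooth field: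
* jointly smooth, `Fl x 0 = x`, group law (tree);
* **DECK EQUIVARIANCE** `Fl (x + (1, 0)) t = Fl x t + (1, 0)` for a `1`-periodic field — the flow descends to
  `S¹ × ℝ²`, so `B ∘ desc ∘ Fl_t ∘ lift` does not depend on the lift (§1);
* **LEVEL TRANSPORT** `Q (Fl x t) = Q x + c t` as long as the orbit stays in a region where `dQ (V) = c`
  (FIBRED clause; first integrals for `c = 0`) (§1);
* **UNIQUENESS**: integral curves of `V` are flow lines (BELOW/SIDES: the lifted chart lines are `W`-curves) (§1);
* **FLOW-OUT IMMERSION**: `(y, t) ↦ Fl (P y) t` has injective differential at `(y₀, t₀)` as soon as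
  `(v, τ) ↦ DP_{y₀} v + τ V (P y₀)` is injective (transversal slice), and the time-`t` maps are injective (§2).

Everything is proved; no definitions, no named facts, no `sorry`.  References: S. Lang, *Differential and
Riemannian Manifolds* (1995), IV §1 [Lang1995]; J. M. Lee, *Introduction to Smooth Manifolds* (2012), Thm. 9.20,
Thm. 9.22 [LeeSmoothManifolds2013].
-/

noncomputable section

set_option linter.dupNamespace false

open scoped Manifold ContDiff Topology NNReal
open Set Function Metric Filter
open Literature.Analysis.ODE Literature.Geometry.Manifold

namespace Summit.SmoothPoincare4.SmoothPoincare4.Theorems.AcyclicBisectionExists.ModpBraidOrbits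

namespace BeltFlow

variable {V : ℝ × EuclideanSpace ℝ (Fin 2) → ℝ × EuclideanSpace ℝ (Fin 2)} {K : ℝ≥0} {L : ℝ}

/-! ## §1 Deck equivariance, level transport, uniqueness -/

/-- **Deck equivariance of the flow of a `1`-periodic field**: `Fl (x + (1,0)) t = Fl x t + (1,0)`.
[cite: Lang1995, Ch. IV §1, Thm. 1.3] -/
theorem globalFlow_add_one (hK : LipschitzWith K V) (hL : ∀ p, ‖V p‖ ≤ L)
    (h1 : ∀ (u : ℝ) (m : EuclideanSpace ℝ (Fin 2)), V (u + 1, m) = V (u, m))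
    (x : ℝ × EuclideanSpace ℝ (Fin 2)) (t : ℝ) :
    globalFlow hK hL (x + ((1 : ℝ), (0 : EuclideanSpace ℝ (Fin 2)))) t =
      globalFlow hK hL x t + ((1 : ℝ), (0 : EuclideanSpace ℝ (Fin 2))) := by
  set γ : ℝ → ℝ × EuclideanSpace ℝ (Fin 2) := fun s => globalFlow hK hL x s + ((1 : ℝ), (0 : EuclideanSpace ℝ (Fin 2)))
    with hγ
  have hVa : ∀ y : ℝ × EuclideanSpace ℝ (Fin 2), V (y + ((1 : ℝ), (0 : EuclideanSpace ℝ (Fin 2)))) = V y := by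
    rintro ⟨u, m⟩
    show V (u + 1, m + 0) = V (u, m)
    rw [add_zero, h1]
  have hγd : ∀ s, HasDerivAt γ (V (γ s)) s := fun s => by
    have h := (hasDerivAt_globalFlow hK hL x s).add_const ((1 : ℝ), (0 : EuclideanSpace ℝ (Fin 2)))
    rw [hγ, hVa]
    exact h
  have ht : t ∈ Ioo (-(|t| + 1)) (|t| + 1) := by constructor <;> cases abs_cases t <;> linarith
  have h := eqOn_globalFlow hK hL (γ := γ) (a := -(|t| + 1)) (b := |t| + 1)
    ⟨by linarith [abs_nonneg t], by linarith [abs_nonneg t]⟩ (fun s _ => hγd s) ht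
  have h0 : γ 0 = x + ((1 : ℝ), (0 : EuclideanSpace ℝ (Fin 2))) := by simp [hγ]
  rw [h0] at h
  exact h.symm

/-- **Level transport**: if `dQ (V) = c` on an open region `S` and the orbit segment `Fl x [0, t]` stays in
`S`, then `Q (Fl x t) = Q x + c t` (mean value theorem for `s ↦ Q (Fl x s) − c s`). [folklore] -/
theorem apply_globalFlow_eq_add (hK : LipschitzWith K V) (hL : ∀ p, ‖V p‖ ≤ L)
    {Q : ℝ × EuclideanSpace ℝ (Fin 2) → ℝ} {S : Set (ℝ × EuclideanSpace ℝ (Fin 2))} {c : ℝ}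
    (hS : IsOpen S) (hQ : DifferentiableOn ℝ Q S) (hQV : ∀ p ∈ S, fderiv ℝ Q p (V p) = c)
    (x : ℝ × EuclideanSpace ℝ (Fin 2)) (t : ℝ) (hin : ∀ s ∈ uIcc 0 t, globalFlow hK hL x s ∈ S) :
    Q (globalFlow hK hL x t) = Q x + c * t := by
  set f : ℝ → ℝ := fun s => Q (globalFlow hK hL x s) - c * s with hf
  have hfd : ∀ s ∈ uIcc 0 t, HasDerivWithinAt f 0 (uIcc 0 t) s := by
    intro s hs
    have hQd : DifferentiableAt ℝ Q (globalFlow hK hL x s) := hQ.differentiableAt (hS.mem_nhds (hin s hs))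
    have h1 := hQd.hasFDerivAt.comp_hasDerivAt s (hasDerivAt_globalFlow hK hL x s)
    rw [hQV _ (hin s hs)] at h1
    have h2 := h1.sub ((hasDerivAt_id s).const_mul c)
    rw [mul_one, sub_self] at h2
    exact h2.hasDerivWithinAt
  have hmv := (convex_uIcc 0 t).norm_image_sub_le_of_norm_hasDerivWithin_le hfd
    (fun s _ => le_of_eq norm_zero) left_mem_uIcc right_mem_uIcc
  rw [zero_mul, norm_le_zero_iff, sub_eq_zero] at hmv
  have h0 : f 0 = Q x := by simp [hf]
  have : f t = Q x := hmv.trans h0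
  simp only [hf] at this
  linarith

/-- **Uniqueness**: an integral curve of `V` on an open interval around `0` is the flow line of its initial
point (tree: `eqOn_globalFlow`). [cite: Lang1995, Ch. IV §1, Thm. 1.3] -/
theorem globalFlow_eq_of_hasDerivAt (hK : LipschitzWith K V) (hL : ∀ p, ‖V p‖ ≤ L)
    (ξ : ℝ → ℝ × EuclideanSpace ℝ (Fin 2)) {a b : ℝ} (h0 : (0 : ℝ) ∈ Ioo a b)
    (hξ : ∀ s ∈ Ioo a b, HasDerivAt ξ (V (ξ s)) s) {t : ℝ} (ht : t ∈ Ioo a b) :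
    globalFlow hK hL (ξ 0) t = ξ t :=
  (eqOn_globalFlow hK hL h0 hξ ht).symm

/-! ## §2 The flow-out chart: injective time-`t` maps and immersion from a transversal slice -/

/-- The time-`t` map of the flow is injective (its inverse is the time-`(−t)` map). [folklore] -/
theorem globalFlow_injective (hK : LipschitzWith K V) (hL : ∀ p, ‖V p‖ ≤ L) (t : ℝ) :
    Injective (fun x => globalFlow hK hL x t) := fun x y hxy => by
  have h := congrArg (fun z => globalFlow hK hL z (-t)) hxy
  simpa only [globalFlow_neg_globalFlow] using h

/-- The differential of the time-`t₀` map is injective (chain rule on `Fl_{−t₀} ∘ Fl_{t₀} = id`). [folklore] -/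
theorem injective_fderiv_globalFlow_time (hV : ContDiff ℝ ∞ V) (hK : LipschitzWith K V) (hL : ∀ p, ‖V p‖ ≤ L)
    (t₀ : ℝ) (z : ℝ × EuclideanSpace ℝ (Fin 2)) :
    Injective (fderiv ℝ (fun x => globalFlow hK hL x t₀) z) := by
  have hF : ContDiff ℝ ∞ (fun q : (ℝ × EuclideanSpace ℝ (Fin 2)) × ℝ => globalFlow hK hL q.1 q.2) :=
    contDiff_globalFlow (n := (⊤ : ℕ∞)) hV le_top hK hL
  have hT : ∀ s : ℝ, Differentiable ℝ (fun x : ℝ × EuclideanSpace ℝ (Fin 2) => globalFlow hK hL x s) := fun s =>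
    (hF.comp (contDiff_id.prodMk contDiff_const)).differentiable (by simp)
  have hcomp := ((hT (-t₀)) (globalFlow hK hL z t₀)).hasFDerivAt.comp z ((hT t₀) z).hasFDerivAt
  have e : ((fun x : ℝ × EuclideanSpace ℝ (Fin 2) => globalFlow hK hL x (-t₀)) ∘
      fun x : ℝ × EuclideanSpace ℝ (Fin 2) => globalFlow hK hL x t₀) = id := by
    funext x
    simp [globalFlow_neg_globalFlow]
  rw [e] at hcomp
  have hid := hcomp.unique (hasFDerivAt_id z)
  intro a b hab
  have := congrArg (fderiv ℝ (fun x : ℝ × EuclideanSpace ℝ (Fin 2) => globalFlow hK hL x (-t₀)) (globalFlow hK hL z t₀)) hab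
  rw [← ContinuousLinearMap.comp_apply, ← ContinuousLinearMap.comp_apply, hid] at this
  exact this

/-- **Flow-out immersion**: if `P` is differentiable at `y₀` and `(v, τ) ↦ DP_{y₀} v + τ V (P y₀)` is injective,
then `(y, t) ↦ Fl (P y) t` has injective differential at every `(y₀, t₀)` (it is `Fl_{t₀}` after the flow-out
at time `t − t₀`, whose differential on the slice is `(v, τ) ↦ DP v + τ V`). [cite: LeeSmoothManifolds2013, Thm. 9.20] -/
theorem injective_fderiv_flowOut (hV : ContDiff ℝ ∞ V) (hK : LipschitzWith K V) (hL : ∀ p, ‖V p‖ ≤ L)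
    {P : ℝ × ℝ → ℝ × EuclideanSpace ℝ (Fin 2)} {y₀ : ℝ × ℝ} (t₀ : ℝ) (hP : DifferentiableAt ℝ P y₀)
    (hinj : Injective (fun q : (ℝ × ℝ) × ℝ => fderiv ℝ P y₀ q.1 + q.2 • V (P y₀))) :
    Injective (fderiv ℝ (fun q : (ℝ × ℝ) × ℝ => globalFlow hK hL (P q.1) q.2) (y₀, t₀)) := by
  have hF : ContDiff ℝ ∞ (fun q : (ℝ × EuclideanSpace ℝ (Fin 2)) × ℝ => globalFlow hK hL q.1 q.2) :=
    contDiff_globalFlow (n := (⊤ : ℕ∞)) hV le_top hK hL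
  have hFd : Differentiable ℝ (fun q : (ℝ × EuclideanSpace ℝ (Fin 2)) × ℝ => globalFlow hK hL q.1 q.2) :=
    hF.differentiable (by simp)
  -- `Φ₀ (y, t) := Fl (P y) (t − t₀)` and `Ψ x := Fl x t₀`; `Φ = Ψ ∘ Φ₀`
  set Φ₀ : (ℝ × ℝ) × ℝ → ℝ × EuclideanSpace ℝ (Fin 2) := fun q => globalFlow hK hL (P q.1) (q.2 - t₀) with hΦ₀
  set Ψ : ℝ × EuclideanSpace ℝ (Fin 2) → ℝ × EuclideanSpace ℝ (Fin 2) := fun x => globalFlow hK hL x t₀ with hΨ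
  have hcomp_eq : (fun q : (ℝ × ℝ) × ℝ => globalFlow hK hL (P q.1) q.2) = Ψ ∘ Φ₀ := by
    funext q
    show globalFlow hK hL (P q.1) q.2 = globalFlow hK hL (globalFlow hK hL (P q.1) (q.2 - t₀)) t₀
    rw [← globalFlow_add, sub_add_cancel]
  -- the differential of `Φ₀` at `(y₀, t₀)` is `(v, τ) ↦ DP v + τ V (P y₀)`
  set A : (ℝ × ℝ) × ℝ → (ℝ × EuclideanSpace ℝ (Fin 2)) × ℝ := fun q => (P q.1, q.2 - t₀) with hA
  set LA : ((ℝ × ℝ) × ℝ) →L[ℝ] (ℝ × EuclideanSpace ℝ (Fin 2)) × ℝ :=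
    ((fderiv ℝ P y₀).comp (ContinuousLinearMap.fst ℝ (ℝ × ℝ) ℝ)).prod (ContinuousLinearMap.snd ℝ (ℝ × ℝ) ℝ) with hLA
  have hLAa : ∀ a : (ℝ × ℝ) × ℝ, LA a = (fderiv ℝ P y₀ a.1, a.2) := fun a => rfl
  have hAd : HasFDerivAt A LA (y₀, t₀) := by
    have h1 : HasFDerivAt (fun q : (ℝ × ℝ) × ℝ => P q.1) ((fderiv ℝ P y₀).comp (ContinuousLinearMap.fst ℝ (ℝ × ℝ) ℝ))
        (y₀, t₀) := hP.hasFDerivAt.comp _ hasFDerivAt_fst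
    have h2 : HasFDerivAt (fun q : (ℝ × ℝ) × ℝ => q.2 - t₀) (ContinuousLinearMap.snd ℝ (ℝ × ℝ) ℝ) (y₀, t₀) :=
      hasFDerivAt_snd.sub_const t₀
    exact h1.prodMk h2
  have hA0 : A (y₀, t₀) = (P y₀, 0) := by simp [hA]
  have hΦ₀d : HasFDerivAt Φ₀ ((fderiv ℝ (fun q : (ℝ × EuclideanSpace ℝ (Fin 2)) × ℝ => globalFlow hK hL q.1 q.2)
      (P y₀, 0)).comp LA) (y₀, t₀) := by
    have hFa : HasFDerivAt (fun q : (ℝ × EuclideanSpace ℝ (Fin 2)) × ℝ => globalFlow hK hL q.1 q.2)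
        (fderiv ℝ (fun q : (ℝ × EuclideanSpace ℝ (Fin 2)) × ℝ => globalFlow hK hL q.1 q.2) (P y₀, 0)) (A (y₀, t₀)) := by
      rw [hA0]; exact (hFd _).hasFDerivAt
    have h := hFa.comp (y₀, t₀) hAd
    exact h
  have hval : ∀ a : (ℝ × ℝ) × ℝ, ((fderiv ℝ (fun q : (ℝ × EuclideanSpace ℝ (Fin 2)) × ℝ => globalFlow hK hL q.1 q.2)
      (P y₀, 0)).comp LA) a = fderiv ℝ P y₀ a.1 + a.2 • V (P y₀) := fun a => by
    rw [ContinuousLinearMap.comp_apply, hLAa, fderiv_globalFlow_zero hK hL hV (n := (⊤ : ℕ∞)) le_top]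
  have hΦ₀inj : Injective (fderiv ℝ Φ₀ (y₀, t₀)) := by
    rw [hΦ₀d.fderiv]
    intro a b hab
    apply hinj
    show fderiv ℝ P y₀ a.1 + a.2 • V (P y₀) = fderiv ℝ P y₀ b.1 + b.2 • V (P y₀)
    rw [← hval, ← hval, hab]
  -- assemble with the injective differential of `Ψ`
  have hΨd : DifferentiableAt ℝ Ψ (Φ₀ (y₀, t₀)) :=
    ((hF.comp (contDiff_id.prodMk contDiff_const)).differentiable (by simp)) _
  rw [hcomp_eq, fderiv_comp (y₀, t₀) hΨd hΦ₀d.differentiableAt]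
  exact (injective_fderiv_globalFlow_time hV hK hL t₀ (Φ₀ (y₀, t₀))).comp hΦ₀inj

end BeltFlow

open BeltFlow

/-! ## §3 The registered package -/

/-- **Sub-goal `helper_beltFlowChart` of stub `stub_M2geo`** (N1 ▸ `node_N1_move` ▸ (d) N1-mono, analytic layer of
piece (d7); wave 8, lead c5).  THE FLOW OF THE TRANSVERSAL FIELD IN FLAT BELT COORDINATES: for a smooth, globally
Lipschitz, bounded, `1`-periodic field `V` on `ℝ × ℝ²` (piece (d6)), its complete flow
`Fl x t := Literature.Analysis.ODE.globalFlow hK hL x t` is jointly smooth, starts at the identity, satisfies the group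
law, is DECK EQUIVARIANT (`Fl (x + (1,0)) t = Fl x t + (1,0)`: it descends to `S¹ × ℝ²`), transports LEVELS
(`Q (Fl x t) = Q x + c t` while the orbit stays in an open region where `dQ (V) = c`), is UNIQUE (integral curves
are flow lines), and its flow-out `(y, t) ↦ Fl (P y) t` from a slice `P` is an IMMERSION at `(y₀, t₀)` as soon as
`(v, τ) ↦ DP_{y₀} v + τ V (P y₀)` is injective, with injective time-`t` maps.
[cite: LeeSmoothManifolds2013, Thm. 9.20 and Thm. 9.22] -/
theorem helper_beltFlowChart : ∀ (V : ℝ × EuclideanSpace ℝ (Fin 2) → ℝ × EuclideanSpace ℝ (Fin 2)) (K : NNReal) (L : ℝ) (hV : ContDiff ℝ ∞ V) (hK : LipschitzWith K V) (hL : ∀ p, ‖V p‖ ≤ L), (∀ (u : ℝ) (m : EuclideanSpace ℝ (Fin 2)), V (u + 1, m) = V (u, m)) → ContDiff ℝ ∞ (fun q : (ℝ × EuclideanSpace ℝ (Fin 2)) × ℝ => Literature.Analysis.ODE.globalFlow hK hL q.1 q.2) ∧ (∀ x, Literature.Analysis.ODE.globalFlow hK hL x 0 = x) ∧ (∀ x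 (s t : ℝ), Literature.Analysis.ODE.globalFlow hK hL x (s + t) = Literature.Analysis.ODE.globalFlow hK hL (Literature.Analysis.ODE.globalFlow hK hL x s) t) ∧ (∀ (x : ℝ × EuclideanSpace ℝ (Fin 2)) (t : ℝ), Literature.Analysis.ODE.globalFlow hK hL (x + ((1 : ℝ), (0 : EuclideanSpace ℝ (Fin 2)))) t = Literature.Analysis.ODE.globalFlow hK hL x t + ((1 : ℝ), (0 : EuclideanSpace ℝ (Fin 2)))) ∧ (∀ (Q : ℝ × EuclideanSpace ℝ (Fin 2) → ℝ) (S : Set (ℝ × EuclideanSpace ℝ (Fin 2))) (c : ℝ), IsOpen S → DifferentiableOn ℝ Q S → (∀ p ∈ S, fderiv ℝ Q p (V p) = c) → ∀ (x : ℝ × EuclideanSpace ℝ (Fin 2)) (t : ℝ), (∀ s ∈ Set.uIcc 0 t, Literature.Analysis.ODE.globalFlow hK hL x s ∈ S) → Q (Literature.Analysis.ODE.globalFlow hK hL x t) = Q x + c * t) ∧ (∀ (ξ : ℝ → ℝ × EuclideanSpace ℝ (Fin 2)) (a b : ℝ), (0 : ℝ) ∈ Set.Ioo a b → (∀ s ∈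 Set.Ioo a b, HasDerivAt ξ (V (ξ s)) s) → ∀ t ∈ Set.Ioo a b, Literature.Analysis.ODE.globalFlow hK hL (ξ 0) t = ξ t) ∧ (∀ (P : ℝ × ℝ → ℝ × EuclideanSpace ℝ (Fin 2)) (y₀ : ℝ × ℝ) (t₀ : ℝ), DifferentiableAt ℝ P y₀ → Function.Injective (fun q : (ℝ × ℝ) × ℝ => fderiv ℝ P y₀ q.1 + q.2 • V (P y₀)) → Function.Injective (fderiv ℝ (fun q : (ℝ × ℝ) × ℝ => Literature.Analysis.ODE.globalFlow hK hL (P q.1) q.2) (y₀, t₀))) ∧ (∀ t : ℝ, Function.Injective (fun x => Literature.Analysis.ODE.globalFlow hK hL x t)) := by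
  intro V K L hV hK hL h1
  refine ⟨contDiff_globalFlow (n := (⊤ : ℕ∞)) hV le_top hK hL, globalFlow_zero hK hL, globalFlow_add hK hL,
    globalFlow_add_one hK hL h1, fun Q S c hS hQ hQV x t hin => apply_globalFlow_eq_add hK hL hS hQ hQV x t hin,
    fun ξ a b h0 hξ t ht => globalFlow_eq_of_hasDerivAt hK hL ξ h0 hξ ht,
    fun P y₀ t₀ hP hinj => injective_fderiv_flowOut hV hK hL t₀ hP hinj, globalFlow_injective hK hL⟩

end Summit.SmoothPoincare4.SmoothPoincare4.Theorems.AcyclicBisectionExists.ModpBraidOrbits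

end
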